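import Mathlib
import HarnessLib
import Summits.ValiantsHypothesis.ValiantsHypothesis.Theorems.KPlusLogSqLawWeakLiftingTowerGraftWronskianKFourRoots

/-!
# Tower graft line — CONJECTURE W AT `K = 4`: THE POSITIVE ZEROS OF THE WRONSKIAN LIE OUTSIDE THE SPAN OF THE THREE POLES

Helper file for LINE (B) `Cruxes/WeakLifting/Lines/tower_graft.lean` (crux `WeakLifting` = stmt-ValiantsHypothesis-19561), combining
`…WronskianKFourLevels` / `…KFourQuotients` (localizations `U₁U₂ < 0`, `U₂U₃ < 0`, `U₁U₃ > 0` at a zero, or a common zero) with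
`…KFourRoots` (unique positive roots `ρ₁, ρ₂, ρ₃` of `U₁, U₂, U₃` and their side signs).  NO stub is claimed.  On the fully alternating
Plücker cell (`p₀₁p₀₂, p₀₂p₀₃, p₀₃p₁₂, p₁₂p₁₃, p₁₃p₂₃ < 0`; forced by five zeros on the orientation `d₀ + d₃ < d₁ + d₂`):

* `root_eq_of_structure` — a positive root of `U_k` is THE root `ρ_k`: uniqueness from the side signs of `…KFourRoots`;
* ★ `wronskian_root_not_between12`, `…23`, `…13` — if a positive zero `x` of `W(u,v)` lies weakly between a positive root of `U_k` and a
  positive root of `U_l`, then `x` is that common root (`x = ρ_k = ρ_l`);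
* ★★ `wronskian_root_outside_poles` — hence every positive zero of `W(u,v)` lies OUTSIDE the closed interval spanned by `ρ₁, ρ₂, ρ₃`,
  unless it is a common zero of two of `U₁, U₂, U₃` (a double zero of `W`, `…KFourFifthZero`): the geometric form of the memo's
  «all five zeros lie in `(0, min ρ) ∪ (max ρ, ∞)`».

HONEST FRAMING: Conjecture W at `K = 4` remains OPEN; nothing on S4/S4f/S5/S5ᴸ, TowerB, `WeakLifting`, Conjecture B, `MatrixDescartes`
(18050), `VP ≠ VNP`.  Def-free.  Seat: prover leafhand-val-kpluslogsqlaw-1 g11, `--supports stmt-ValiantsHypothesis-19561 --as helper`.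
[this work; ingredients folklore (Descartes, IVT)]
-/

-- `Summit.ValiantsHypothesis.ValiantsHypothesis.…` repeats a component by the D-0017 layout
-- (single-conjunct summit), which the `dupNamespace` linter flags; the name is mandated.
set_option linter.dupNamespace false
set_option autoImplicit false

namespace Summit.ValiantsHypothesis.ValiantsHypothesis.Theorems.KPlusLogSqLaw.TowerGraft

open Polynomial Finset
open scoped BigOperators Polynomial
open Summit.ValiantsHypothesis.ValiantsHypothesis.Theorems.LacunarySymmetroidMatrixDescartes.Census
  (mul_pos_of_mul_neg_of_mul_neg mul_neg_of_mul_pos_of_mul_neg)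

namespace WronskianDevelopable

/-- generic uniqueness step: from a root structure `(ρ, sign before, sign after)` a positive root equals `ρ`. [folklore] -/
theorem root_eq_of_structure {P : ℝ → ℝ} {s ρ y : ℝ} (hbefore : ∀ x : ℝ, 0 < x → x < ρ → 0 < s * P x)
    (hafter : ∀ x : ℝ, ρ < x → s * P x < 0) (hy : 0 < y) (hPy : P y = 0) : y = ρ := by
  rcases lt_trichotomy y ρ with hlt | heq | hgt
  · have := hbefore y hy hlt; rw [hPy, mul_zero] at this; exact absurd this (lt_irrefl 0)
  · exact heq
  · have := hafter y hgt; rw [hPy, mul_zero] at this; exact absurd this (lt_irrefl 0)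

section Cell

variable (u v : Fin 4 → ℝ) (d : Fin 4 → ℕ) (hd : StrictMono d)
  (h1 : (u 0 * v 1 - u 1 * v 0) * (u 0 * v 2 - u 2 * v 0) < 0) (h2 : (u 0 * v 2 - u 2 * v 0) * (u 0 * v 3 - u 3 * v 0) < 0)
  (h3 : (u 0 * v 3 - u 3 * v 0) * (u 1 * v 2 - u 2 * v 1) < 0) (h4 : (u 1 * v 2 - u 2 * v 1) * (u 1 * v 3 - u 3 * v 1) < 0)
  (h5 : (u 1 * v 3 - u 3 * v 1) * (u 2 * v 3 - u 3 * v 2) < 0)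
include hd h1 h2 h3 h4 h5

/-- ★ **pair `(U₁,U₂)`**: a positive zero of `W(u,v)` weakly between a positive root `y` of `U₁` and a positive root `z` of `U₂` is
their common root. [this work] -/
theorem wronskian_root_not_between12 {x y z : ℝ} (hx : 0 < x)
    (hW : (wronskian (∑ l, C (u l) * (X : ℝ[X]) ^ d l) (∑ l, C (v l) * (X : ℝ[X]) ^ d l)).eval x = 0)
    (hy : 0 < y) (hUy : (∑ l, C (u l * v 1 - u 1 * v l) * (X : ℝ[X]) ^ d l).eval y = 0)
    (hz : 0 < z) (hUz : (∑ l, C (u l * v 2 - u 2 * v l) * (X : ℝ[X]) ^ d l).eval z = 0)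
    (hbetween : (y ≤ x ∧ x ≤ z) ∨ (z ≤ x ∧ x ≤ y)) : x = y ∧ x = z := by
  obtain ⟨ρ₁, hρ₁, -, hb1, ha1⟩ := special_one_root_structure u v d hd h1 h2 h3 h4 h5
  obtain ⟨ρ₂, hρ₂, -, hb2, ha2⟩ := special_two_root_structure u v d hd h1 h2 h3 h4 h5
  set U₁ : ℝ[X] := ∑ l, C (u l * v 1 - u 1 * v l) * (X : ℝ[X]) ^ d l with hU₁
  set U₂ : ℝ[X] := ∑ l, C (u l * v 2 - u 2 * v l) * (X : ℝ[X]) ^ d l with hU₂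
  have hy1 : y = ρ₁ := root_eq_of_structure (P := fun t => U₁.eval t) hb1 ha1 hy hUy
  have hz2 : z = ρ₂ := root_eq_of_structure (P := fun t => U₂.eval t) hb2 ha2 hz hUz
  rcases wronskian_root_special_product_neg u v d hd h1 h2 h3 h4 h5 hx hW with hneg | ⟨hz1, hz2'⟩
  · exfalso
    -- signs of `p₀₁U₁(x)` and `p₀₂U₂(x)` from the position of `x`
    have key : (u 0 * v 1 - u 1 * v 0) * U₁.eval x * ((u 0 * v 2 - u 2 * v 0) * U₂.eval x) ≤ 0 := by
      rcases hbetween with ⟨hyx, hxz⟩ | ⟨hzx, hxy⟩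
      · have s1 : (u 0 * v 1 - u 1 * v 0) * U₁.eval x ≤ 0 := by
          rcases lt_or_eq_of_le hyx with hlt | heq
          · exact (ha1 x (by rw [← hy1]; exact hlt)).le
          · rw [← heq, hUy, mul_zero]
        have s2 : 0 ≤ (u 0 * v 2 - u 2 * v 0) * U₂.eval x := by
          rcases lt_or_eq_of_le hxz with hlt | heq
          · exact (hb2 x hx (by rw [← hz2]; exact hlt)).le
          · rw [heq, hUz, mul_zero]
        exact mul_nonpos_of_nonpos_of_nonneg s1 s2  |> fun h => by nlinarith [h]
      · have s1 : 0 ≤ (u 0 * v 1 - u 1 * v 0) * U₁.eval x := by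
          rcases lt_or_eq_of_le hxy with hlt | heq
          · exact (hb1 x hx (by rw [← hy1]; exact hlt)).le
          · rw [heq, hUy, mul_zero]
        have s2 : (u 0 * v 2 - u 2 * v 0) * U₂.eval x ≤ 0 := by
          rcases lt_or_eq_of_le hzx with hlt | heq
          · exact (ha2 x (by rw [← hz2]; exact hlt)).le
          · rw [← heq, hUz, mul_zero]
        exact mul_nonpos_of_nonneg_of_nonpos s1 s2 |> fun h => by nlinarith [h]
    -- but `p₀₁p₀₂ < 0` and `U₁U₂ < 0` make that product positive
    have e : (u 0 * v 1 - u 1 * v 0) * U₁.eval x * ((u 0 * v 2 - u 2 * v 0) * U₂.eval x) =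
        ((u 0 * v 1 - u 1 * v 0) * (u 0 * v 2 - u 2 * v 0)) * (U₁.eval x * U₂.eval x) := by ring
    rw [e] at key
    have : 0 < ((u 0 * v 1 - u 1 * v 0) * (u 0 * v 2 - u 2 * v 0)) * (U₁.eval x * U₂.eval x) := mul_pos_of_neg_of_neg h1 hneg
    linarith
  · have hx1 : x = ρ₁ := root_eq_of_structure (P := fun t => U₁.eval t) hb1 ha1 hx hz1
    have hx2 : x = ρ₂ := root_eq_of_structure (P := fun t => U₂.eval t) hb2 ha2 hx hz2'
    exact ⟨by rw [hx1, hy1], by rw [hx2, hz2]⟩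

/-- ★ **pair `(U₂,U₃)`**. [this work] -/
theorem wronskian_root_not_between23 {x y z : ℝ} (hx : 0 < x)
    (hW : (wronskian (∑ l, C (u l) * (X : ℝ[X]) ^ d l) (∑ l, C (v l) * (X : ℝ[X]) ^ d l)).eval x = 0)
    (hy : 0 < y) (hUy : (∑ l, C (u l * v 2 - u 2 * v l) * (X : ℝ[X]) ^ d l).eval y = 0)
    (hz : 0 < z) (hUz : (∑ l, C (u l * v 3 - u 3 * v l) * (X : ℝ[X]) ^ d l).eval z = 0)
    (hbetween : (y ≤ x ∧ x ≤ z) ∨ (z ≤ x ∧ x ≤ y)) : x = y ∧ x = z := by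
  obtain ⟨ρ₂, hρ₂, -, hb2, ha2⟩ := special_two_root_structure u v d hd h1 h2 h3 h4 h5
  obtain ⟨ρ₃, hρ₃, -, hb3, ha3⟩ := special_three_root_structure u v d hd h1 h2 h3 h4 h5
  set U₂ : ℝ[X] := ∑ l, C (u l * v 2 - u 2 * v l) * (X : ℝ[X]) ^ d l with hU₂
  set U₃ : ℝ[X] := ∑ l, C (u l * v 3 - u 3 * v l) * (X : ℝ[X]) ^ d l with hU₃
  have hy2 : y = ρ₂ := root_eq_of_structure (P := fun t => U₂.eval t) hb2 ha2 hy hUy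
  have hz3 : z = ρ₃ := root_eq_of_structure (P := fun t => U₃.eval t) hb3 ha3 hz hUz
  rcases wronskian_root_special_product23_neg u v d hd h1 h2 h3 h4 h5 hx hW with hneg | ⟨hz1, hz2'⟩
  · exfalso
    have key : (u 0 * v 2 - u 2 * v 0) * U₂.eval x * ((u 0 * v 3 - u 3 * v 0) * U₃.eval x) ≤ 0 := by
      rcases hbetween with ⟨hyx, hxz⟩ | ⟨hzx, hxy⟩
      · have s1 : (u 0 * v 2 - u 2 * v 0) * U₂.eval x ≤ 0 := by
          rcases lt_or_eq_of_le hyx with hlt | heq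
          · exact (ha2 x (by rw [← hy2]; exact hlt)).le
          · rw [← heq, hUy, mul_zero]
        have s2 : 0 ≤ (u 0 * v 3 - u 3 * v 0) * U₃.eval x := by
          rcases lt_or_eq_of_le hxz with hlt | heq
          · exact (hb3 x hx (by rw [← hz3]; exact hlt)).le
          · rw [heq, hUz, mul_zero]
        exact mul_nonpos_of_nonpos_of_nonneg s1 s2 |> fun h => by nlinarith [h]
      · have s1 : 0 ≤ (u 0 * v 2 - u 2 * v 0) * U₂.eval x := by
          rcases lt_or_eq_of_le hxy with hlt | heq
          · exact (hb2 x hx (by rw [← hy2]; exact hlt)).le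
          · rw [heq, hUy, mul_zero]
        have s2 : (u 0 * v 3 - u 3 * v 0) * U₃.eval x ≤ 0 := by
          rcases lt_or_eq_of_le hzx with hlt | heq
          · exact (ha3 x (by rw [← hz3]; exact hlt)).le
          · rw [← heq, hUz, mul_zero]
        exact mul_nonpos_of_nonneg_of_nonpos s1 s2 |> fun h => by nlinarith [h]
    have e : (u 0 * v 2 - u 2 * v 0) * U₂.eval x * ((u 0 * v 3 - u 3 * v 0) * U₃.eval x) =
        ((u 0 * v 2 - u 2 * v 0) * (u 0 * v 3 - u 3 * v 0)) * (U₂.eval x * U₃.eval x) := by ring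
    rw [e] at key
    have : 0 < ((u 0 * v 2 - u 2 * v 0) * (u 0 * v 3 - u 3 * v 0)) * (U₂.eval x * U₃.eval x) := mul_pos_of_neg_of_neg h2 hneg
    linarith
  · have hx2 : x = ρ₂ := root_eq_of_structure (P := fun t => U₂.eval t) hb2 ha2 hx hz1
    have hx3 : x = ρ₃ := root_eq_of_structure (P := fun t => U₃.eval t) hb3 ha3 hx hz2'
    exact ⟨by rw [hx2, hy2], by rw [hx3, hz3]⟩

/-- ★ **pair `(U₁,U₃)`** (here `p₀₁p₀₃ > 0` and `U₁U₃ > 0` at a zero). [this work] -/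
theorem wronskian_root_not_between13 {x y z : ℝ} (hx : 0 < x)
    (hW : (wronskian (∑ l, C (u l) * (X : ℝ[X]) ^ d l) (∑ l, C (v l) * (X : ℝ[X]) ^ d l)).eval x = 0)
    (hy : 0 < y) (hUy : (∑ l, C (u l * v 1 - u 1 * v l) * (X : ℝ[X]) ^ d l).eval y = 0)
    (hz : 0 < z) (hUz : (∑ l, C (u l * v 3 - u 3 * v l) * (X : ℝ[X]) ^ d l).eval z = 0)
    (hbetween : (y ≤ x ∧ x ≤ z) ∨ (z ≤ x ∧ x ≤ y)) : x = y ∧ x = z := by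
  obtain ⟨ρ₁, hρ₁, -, hb1, ha1⟩ := special_one_root_structure u v d hd h1 h2 h3 h4 h5
  obtain ⟨ρ₃, hρ₃, -, hb3, ha3⟩ := special_three_root_structure u v d hd h1 h2 h3 h4 h5
  have h13 : 0 < (u 0 * v 1 - u 1 * v 0) * (u 0 * v 3 - u 3 * v 0) := mul_pos_of_mul_neg_of_mul_neg h1 h2
  set U₁ : ℝ[X] := ∑ l, C (u l * v 1 - u 1 * v l) * (X : ℝ[X]) ^ d l with hU₁
  set U₃ : ℝ[X] := ∑ l, C (u l * v 3 - u 3 * v l) * (X : ℝ[X]) ^ d l with hU₃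
  have hy1 : y = ρ₁ := root_eq_of_structure (P := fun t => U₁.eval t) hb1 ha1 hy hUy
  have hz3 : z = ρ₃ := root_eq_of_structure (P := fun t => U₃.eval t) hb3 ha3 hz hUz
  rcases wronskian_root_special_product13_pos u v d hd h1 h2 h3 h4 h5 hx hW with hpos | ⟨hz1, hz2'⟩
  · exfalso
    have key : (u 0 * v 1 - u 1 * v 0) * U₁.eval x * ((u 0 * v 3 - u 3 * v 0) * U₃.eval x) ≤ 0 := by
      rcases hbetween with ⟨hyx, hxz⟩ | ⟨hzx, hxy⟩
      · have s1 : (u 0 * v 1 - u 1 * v 0) * U₁.eval x ≤ 0 := by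
          rcases lt_or_eq_of_le hyx with hlt | heq
          · exact (ha1 x (by rw [← hy1]; exact hlt)).le
          · rw [← heq, hUy, mul_zero]
        have s2 : 0 ≤ (u 0 * v 3 - u 3 * v 0) * U₃.eval x := by
          rcases lt_or_eq_of_le hxz with hlt | heq
          · exact (hb3 x hx (by rw [← hz3]; exact hlt)).le
          · rw [heq, hUz, mul_zero]
        exact mul_nonpos_of_nonpos_of_nonneg s1 s2 |> fun h => by nlinarith [h]
      · have s1 : 0 ≤ (u 0 * v 1 - u 1 * v 0) * U₁.eval x := by
          rcases lt_or_eq_of_le hxy with hlt | heq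
          · exact (hb1 x hx (by rw [← hy1]; exact hlt)).le
          · rw [heq, hUy, mul_zero]
        have s2 : (u 0 * v 3 - u 3 * v 0) * U₃.eval x ≤ 0 := by
          rcases lt_or_eq_of_le hzx with hlt | heq
          · exact (ha3 x (by rw [← hz3]; exact hlt)).le
          · rw [← heq, hUz, mul_zero]
        exact mul_nonpos_of_nonneg_of_nonpos s1 s2 |> fun h => by nlinarith [h]
    have e : (u 0 * v 1 - u 1 * v 0) * U₁.eval x * ((u 0 * v 3 - u 3 * v 0) * U₃.eval x) =
        ((u 0 * v 1 - u 1 * v 0) * (u 0 * v 3 - u 3 * v 0)) * (U₁.eval x * U₃.eval x) := by ring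
    rw [e] at key
    have : 0 < ((u 0 * v 1 - u 1 * v 0) * (u 0 * v 3 - u 3 * v 0)) * (U₁.eval x * U₃.eval x) := mul_pos h13 hpos
    linarith
  · have hx1 : x = ρ₁ := root_eq_of_structure (P := fun t => U₁.eval t) hb1 ha1 hx hz1
    have hx3 : x = ρ₃ := root_eq_of_structure (P := fun t => U₃.eval t) hb3 ha3 hx hz2'
    exact ⟨by rw [hx1, hy1], by rw [hx3, hz3]⟩

/-- ★★ **THE POSITIVE ZEROS OF `W(u,v)` LIE OUTSIDE THE SPAN OF THE POLES.**  If a positive zero `x` of `W(u,v)` satisfies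
`min(y₁,y₂,y₃) ≤ x ≤ max(y₁,y₂,y₃)` for positive roots `y_k` of `U_k` (stated as: some `y_k ≤ x` and some `x ≤ y_l`), then `x` is a
common root of two of `U₁, U₂, U₃` (hence a double zero of `W`, excluded when there are five zeros). [this work] -/
theorem wronskian_root_outside_poles {x y₁ y₂ y₃ : ℝ} (hx : 0 < x)
    (hW : (wronskian (∑ l, C (u l) * (X : ℝ[X]) ^ d l) (∑ l, C (v l) * (X : ℝ[X]) ^ d l)).eval x = 0)
    (hy₁ : 0 < y₁) (hU₁ : (∑ l, C (u l * v 1 - u 1 * v l) * (X : ℝ[X]) ^ d l).eval y₁ = 0)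
    (hy₂ : 0 < y₂) (hU₂ : (∑ l, C (u l * v 2 - u 2 * v l) * (X : ℝ[X]) ^ d l).eval y₂ = 0)
    (hy₃ : 0 < y₃) (hU₃ : (∑ l, C (u l * v 3 - u 3 * v l) * (X : ℝ[X]) ^ d l).eval y₃ = 0)
    (hlo : y₁ ≤ x ∨ y₂ ≤ x ∨ y₃ ≤ x) (hhi : x ≤ y₁ ∨ x ≤ y₂ ∨ x ≤ y₃) :
    (x = y₁ ∧ x = y₂) ∨ (x = y₂ ∧ x = y₃) ∨ (x = y₁ ∧ x = y₃) := by
  rcases hlo with h1x | h2x | h3x <;> rcases hhi with hx1 | hx2 | hx3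
  · -- `y₁ ≤ x ≤ y₁`
    exact Or.inl (wronskian_root_not_between12 u v d hd h1 h2 h3 h4 h5 hx hW hy₁ hU₁ hy₂ hU₂
      (by rcases le_total x y₂ with h | h
          · exact Or.inl ⟨h1x, h⟩
          · exact Or.inr ⟨h, hx1⟩))
  · exact Or.inl (wronskian_root_not_between12 u v d hd h1 h2 h3 h4 h5 hx hW hy₁ hU₁ hy₂ hU₂ (Or.inl ⟨h1x, hx2⟩))
  · exact Or.inr (Or.inr (wronskian_root_not_between13 u v d hd h1 h2 h3 h4 h5 hx hW hy₁ hU₁ hy₃ hU₃ (Or.inl ⟨h1x, hx3⟩)))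
  · exact Or.inl (wronskian_root_not_between12 u v d hd h1 h2 h3 h4 h5 hx hW hy₁ hU₁ hy₂ hU₂ (Or.inr ⟨h2x, hx1⟩))
  · -- `y₂ ≤ x ≤ y₂`
    exact Or.inr (Or.inl (wronskian_root_not_between23 u v d hd h1 h2 h3 h4 h5 hx hW hy₂ hU₂ hy₃ hU₃
      (by rcases le_total x y₃ with h | h
          · exact Or.inl ⟨h2x, h⟩
          · exact Or.inr ⟨h, hx2⟩)))
  · exact Or.inr (Or.inl (wronskian_root_not_between23 u v d hd h1 h2 h3 h4 h5 hx hW hy₂ hU₂ hy₃ hU₃ (Or.inl ⟨h2x, hx3⟩)))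
  · exact Or.inr (Or.inr (wronskian_root_not_between13 u v d hd h1 h2 h3 h4 h5 hx hW hy₁ hU₁ hy₃ hU₃ (Or.inr ⟨h3x, hx1⟩)))
  · exact Or.inr (Or.inl (wronskian_root_not_between23 u v d hd h1 h2 h3 h4 h5 hx hW hy₂ hU₂ hy₃ hU₃ (Or.inr ⟨h3x, hx2⟩)))
  · -- `y₃ ≤ x ≤ y₃`
    exact Or.inr (Or.inr (wronskian_root_not_between13 u v d hd h1 h2 h3 h4 h5 hx hW hy₁ hU₁ hy₃ hU₃
      (by rcases le_total x y₁ with h | h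
          · exact Or.inr ⟨h3x, h⟩
          · exact Or.inl ⟨h, hx3⟩)))

end Cell

end WronskianDevelopable

end Summit.ValiantsHypothesis.ValiantsHypothesis.Theorems.KPlusLogSqLaw.TowerGraft
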